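import Summits.CriticalPhenomena.PercolationContinuityZ3.Theorems.Transplant.SkelFrmBChoiceCellsV
import Summits.CriticalPhenomena.PercolationContinuityZ3.Theorems.Transplant.SkelPhiCellsSmallMV
import HarnessLib

/-!
# N2 (frames-only node `SamePDropOfSkeletonFrm₁`, OPEN) — THE CHOICE FUNCTION OF RECORD UNDER (R-44)/(R-45), SECOND CELL PORT `V`:
# `NegB.hOf`, `NegB.ΓQV / FDQV / LDQV` (hp-8 g42/g43's `Skelφ.cellGeomSG₂bV / faceDataSGV / levelDataSV` over MY `fcellsV … (cOf …) (hOf …)`,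
# SkelFrmBChoiceCellsV), `NegB.choiceAtQ3V`, **`PlanarSkeletonFrm.frmChoiceAllQ3V gv fv Pv Sv cv hv bv : ChoiceFnNQ`** (SEVEN slots: the forward-room
# slot `hv : CSlot` added to Q3T's six) — definitions + `rfl` lemmas only; lead g12 11:31:15Z/11:46:03Z: the choice function of record MOVES here on ACCEPT
# (wrappers only at Q3V; port first / wrapper last); the node tuple reads `frmChoiceAllQ3V … (NegB.cR2W 0) (NegB.hFR 0) NegB.BSlot.small3`

The V twin of SkelFrmBChoiceDefsT §4–§5 (p360262), token for token: `fcellsT … c ↦ fcellsV … c hf` (`hf := hOf … hv`), `cellGeomSG₂bT/faceDataSGT/levelDataST ↦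
…V`, `PCells2T.Mb ↦ PCells2V.Mb`; the column slot `offNT`, the schedule `schedOfT` and the arrival box `bOf` are UNCHANGED (they read `cenS`/`r`/`s`, which
`PCells2V` inherits: `fcellsV_cenS`, `fcellsV_toPCells2T`).
* `hOf`; `bS_leV`, `bOf_leV` (`b ≤ 3r` over the V cells, = T's rows through `fcellsV_r`); `ΓQV`, `FDQV`, `LDQV`, `ΓQV_root/_a₀/_K/_M/_Q/_Efar/_anchSet`; `choiceAtQ3V` + `choiceAtQ3V_δI/_m₀/_Sz/_SMn/_Γ/_FD/_LD/_scheme`;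
  `frmChoiceAllQ3V`, `frmChoiceAllQ3V_eq`, `frmChoiceAllQ3V_scheme`.
NON-VACUITY (lead g11 standing order): definitions; every slot is free; the V cells are a genuine `PCells2V` for every slot value (truncations `cT`/`hFV`).
builds on p205010 (kernel theorem, internal audit signed; external expert review pending) — nothing in this file uses p205010; NOTHING is claimed about the
open node `SamePDropOfSkeletonFrm₁`.
Lane `prim-bschramm`, seat `prim-bschramm-stmt` (gen 21; `bS_leV/bOf_leV` added gen 22); helper file (`--supports stmt-CriticalPhenomena-4575 --as helper`).
[cite: KozmaNitzan2024, §4 Theorem 6 (pp. 25–31), pp. 25–27 (Q_v, M_v, E_{v,x}, H^j_{v,x})] [cite: MartineauTassion2017, §4.3 (the cell lattice)]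
-/


noncomputable section

open scoped Classical

namespace Summit.CriticalPhenomena.PercolationContinuityZ3.Theorems.Transplant

open MeasureTheory Literature.Probability.Percolation Literature.Probability.LatticeModels SimpleGraph KNCells
open Literature.Barriers.CriticalPhenomena (HasExponentialGrowth)
open Literature.Probability.Percolation.KozmaNitzan.Cells (oth oth_oth)

namespace PlanarSkeletonFrm

open SkelConc (Consts)
open BoxProdZ2 (ConcRadiiG)
open Skelφ (oriφ trφ)
open Skelφ.StepI (DataN DataNS OutNS)

namespace NegB

open Neg

/-! ## §1 The per-axis truncated creep and the staggered cells of record under (R-40) -/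

section Values

variable (κ : Consts) {V : Type} [DecidableEq V] [Countable V] {G : SimpleGraph V} [G.LocallyFinite] (Φ : PlanarSkeletonFrm G) (t : V)
  (p : unitInterval)

variable (Pv : PSlot) (O : OutNS V) (gv fv : Neg.FSlot) (Sv : SSlot) (cv hv : CSlot) (bv : BSlot) (q : unitInterval)

/-- **The forward-room slot value at the merged record**: `hOf := hv … O.merged (gOf …) (fOf …)` (like `cOf`). [this work] -/
def hOf : Fin 2 → ℕ := hv κ Φ t p O.merged (gOf κ Φ t p O gv) (fOf κ Φ t p O fv)

/-- **THE SCHEME OF RECORD OF THE N2 CHAIN at `(O, q)` UNDER (R-44)/(R-45)**: `cellGeomSG₂bV` over the oriented (ζ′) fine map `fineOA`, the V cells `fcellsV` (asymmetric transverse rooms), root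
`t`, schedule `schedOfT (Sv …)`, arrival boxes `bOf` (slot `bv`, truncated at `3r`). [cite: KozmaNitzan2024, §4 pp. 25–27 (Q_v, M_v, E_{v,x}, H^j_{v,x})] -/
def ΓQV : CellGeom V ℕ :=
  Skelφ.cellGeomSG₂bV G (fineOA κ Φ t p O.D O.DT.toDataN O.ori (gOf κ Φ t p O gv) (fOf κ Φ t p O fv))
    (fcellsV κ Φ t p O.merged (gOf κ Φ t p O gv) (fOf κ Φ t p O fv) (cOf κ Φ t p O gv fv cv) (hOf κ Φ t p O gv fv hv)) t
    (schedOfT κ Φ t p O.merged (gOf κ Φ t p O gv) (fOf κ Φ t p O fv) (cOf κ Φ t p O gv fv cv)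
      (Sv κ Φ t p O.merged (gOf κ Φ t p O gv) (fOf κ Φ t p O fv) q))
    (bOf κ Φ t p O gv fv bv)

/-- **The face data of the N2 chain at `(O, q)` under (R-44)/(R-45)** (`faceDataSGV` over `fineOA`/`fcellsV`/`schedOfT`). [this work] -/
def FDQV : FaceData V ℕ :=
  Skelφ.faceDataSGV G (fineOA κ Φ t p O.D O.DT.toDataN O.ori (gOf κ Φ t p O gv) (fOf κ Φ t p O fv))
    (fcellsV κ Φ t p O.merged (gOf κ Φ t p O gv) (fOf κ Φ t p O fv) (cOf κ Φ t p O gv fv cv) (hOf κ Φ t p O gv fv hv)) t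
    (schedOfT κ Φ t p O.merged (gOf κ Φ t p O gv) (fOf κ Φ t p O fv) (cOf κ Φ t p O gv fv cv)
      (Sv κ Φ t p O.merged (gOf κ Φ t p O gv) (fOf κ Φ t p O fv) q))

/-- **The level data of the N2 chain at `O` under (R-44)/(R-45)** (`levelDataSV` over `fineOA`/`fcellsV`). [this work] -/
def LDQV : LevelData V ℕ :=
  Skelφ.levelDataSV (fineOA κ Φ t p O.D O.DT.toDataN O.ori (gOf κ Φ t p O gv) (fOf κ Φ t p O fv))
    (fcellsV κ Φ t p O.merged (gOf κ Φ t p O gv) (fOf κ Φ t p O fv) (cOf κ Φ t p O gv fv cv) (hOf κ Φ t p O gv fv hv))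

/-- The root of the scheme of record is `t` (by `rfl`). [folklore] -/
@[simp] theorem ΓQV_root : (ΓQV κ Φ t p O gv fv Sv cv hv bv q).root = t := rfl

/-- The base anchor of the scheme of record is `0` (by `rfl`). [folklore] -/
@[simp] theorem ΓQV_a₀ : (ΓQV κ Φ t p O gv fv Sv cv hv bv q).a₀ = 0 := rfl

/-- The number of stub levels of the scheme of record is the cells' `K` (by `rfl`). [folklore] -/
theorem ΓQV_K : (ΓQV κ Φ t p O gv fv Sv cv hv bv q).K = (fcellsA κ Φ t p O.merged (gOf κ Φ t p O gv) (fOf κ Φ t p O fv)).K := rfl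

/-- **The arrival box of the scheme of record** (what the (C) residue's `hlastM` and the (R) root leg read): the window span over the SMALL box `Mb bOf v` about the
V centre, radius `rM a v` of `schedOfT`. [folklore] -/
theorem ΓQV_M (a : ℕ) (v : Site 2) : (ΓQV κ Φ t p O gv fv Sv cv hv bv q).M a v =
    Skelφ.VWin G (fineOA κ Φ t p O.D O.DT.toDataN O.ori (gOf κ Φ t p O gv) (fOf κ Φ t p O fv)) t
      (PCells2V.Mb (fcellsV κ Φ t p O.merged (gOf κ Φ t p O gv) (fOf κ Φ t p O fv) (cOf κ Φ t p O gv fv cv) (hOf κ Φ t p O gv fv hv)) (bOf κ Φ t p O gv fv bv) v)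
      ((schedOfT κ Φ t p O.merged (gOf κ Φ t p O gv) (fOf κ Φ t p O fv) (cOf κ Φ t p O gv fv cv)
        (Sv κ Φ t p O.merged (gOf κ Φ t p O gv) (fOf κ Φ t p O fv) q)).rM a v) := rfl

/-- **The cube of the scheme of record**: the window span over `Q v` about the V centre, radius `rQ a v`. [folklore] -/
theorem ΓQV_Q (a : ℕ) (v : Site 2) : (ΓQV κ Φ t p O gv fv Sv cv hv bv q).Q a v =
    Skelφ.VWin G (fineOA κ Φ t p O.D O.DT.toDataN O.ori (gOf κ Φ t p O gv) (fOf κ Φ t p O fv)) t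
      ((fcellsV κ Φ t p O.merged (gOf κ Φ t p O gv) (fOf κ Φ t p O fv) (cOf κ Φ t p O gv fv cv) (hOf κ Φ t p O gv fv hv)).Q v)
      ((schedOfT κ Φ t p O.merged (gOf κ Φ t p O gv) (fOf κ Φ t p O fv) (cOf κ Φ t p O gv fv cv)
        (Sv κ Φ t p O.merged (gOf κ Φ t p O gv) (fOf κ Φ t p O fv) q)).rQ a v) := rfl

/-- The far region of the scheme of record: the window span over the slack two-block far region `FarNS₂ v δ` (about the V NEIGHBOUR), radius `rE a v δ`.
[folklore] -/
theorem ΓQV_Efar (a : ℕ) (v : Site 2) (δ : MDir) : (ΓQV κ Φ t p O gv fv Sv cv hv bv q).Efar a v δ =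
    Skelφ.VWin G (fineOA κ Φ t p O.D O.DT.toDataN O.ori (gOf κ Φ t p O gv) (fOf κ Φ t p O fv)) t
      ((fcellsV κ Φ t p O.merged (gOf κ Φ t p O gv) (fOf κ Φ t p O fv) (cOf κ Φ t p O gv fv cv) (hOf κ Φ t p O gv fv hv)).FarNS₂ v δ)
      ((schedOfT κ Φ t p O.merged (gOf κ Φ t p O gv) (fOf κ Φ t p O fv) (cOf κ Φ t p O gv fv cv)
        (Sv κ Φ t p O.merged (gOf κ Φ t p O gv) (fOf κ Φ t p O fv) q)).rE a v δ) := rfl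

/-- The admissible anchors of the scheme of record are `{a, a+1}` (by `rfl`). [folklore] -/
theorem ΓQV_anchSet (a : ℕ) (v : Site 2) : (ΓQV κ Φ t p O gv fv Sv cv hv bv q).anchSet a v = {a, a + 1} := rfl

/-- **`bS i ≤ 3·r i` over the V cells** (SmallMV's `Mb_subset_M` row `hb`), for EVERY slot value (`r` of the V cells is `fcellsA`'s by `rfl`). [folklore] -/
theorem bS_leV (D : DataNS V) (g f : ℕ) (c hf b : Fin 2 → ℕ) (i : Fin 2) : bS κ Φ t p D g f b i ≤ 3 * (fcellsV κ Φ t p D g f c hf).r i :=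
  bS_leT κ Φ t p D g f c b i

/-- **`bOf ≤ 3r` over the V cells of record**, for every slot value (the Geom column's `hb`; T's `bOf_leT` read through `fcellsV_r`). [folklore] -/
theorem bOf_leV (i : Fin 2) :
    bOf κ Φ t p O gv fv bv i ≤ 3 * (fcellsV κ Φ t p O.merged (gOf κ Φ t p O gv) (fOf κ Φ t p O fv) (cOf κ Φ t p O gv fv cv) (hOf κ Φ t p O gv fv hv)).r i :=
  bOf_leT κ Φ t p O gv fv cv bv i

variable (hC : Φ.CylSubcritical p)

/-- **THE N2 CHOICES OF RECORD at `(κ, Φ, t, p)` UNDER (R-44)/(R-45), SEVEN slots (the forward-room slot `hv` added), Step-I‴ accuracy at the CUBE** — `δI := δI3` ((R-33)), `m₀`, `Sz`,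
`SMn := SMnP` as in p348247, `Γ := ΓQV`, `FD := FDQV`, `LD := LDQV`. [cite: KozmaNitzan2024, §4 Theorem 6 (pp. 25–31)] -/
def choiceAtQ3V : ChoiceNQ κ Φ t p hC where
  δI := δI3 κ Φ
  m₀ := Neg.m₀
  Sz := fun O => Neg.Sz O.merged
  SMn := fun O => SMnP κ Φ t p O.merged (gOf κ Φ t p O gv) (fOf κ Φ t p O fv) Pv
  Γ := fun O q => ΓQV κ Φ t p O gv fv Sv cv hv bv q
  FD := fun O q => FDQV κ Φ t p O gv fv Sv cv hv q
  LD := fun O _ => LDQV κ Φ t p O gv fv cv hv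
  δI_pos := δI3_pos κ Φ
  δI_lt_one := δI3_lt_one κ Φ
  S_adm := fun O _ => ⟨Neg.Sz_adm O.merged, SMnP_adm_at κ Φ t p O.merged _ _ Pv⟩

/-- The Step-I‴ accuracy of the T choices of record is `δI3` (by `rfl`). [folklore] -/
@[simp] theorem choiceAtQ3V_δI : (choiceAtQ3V κ Φ t p Pv gv fv Sv cv hv bv hC).δI = δI3 κ Φ := rfl

/-- The least seed level is the landed one (by `rfl`). [folklore] -/
@[simp] theorem choiceAtQ3V_m₀ : (choiceAtQ3V κ Φ t p Pv gv fv Sv cv hv bv hC).m₀ = (choiceAtQ3 κ Φ t p Pv gv fv Sv cv bv hC).m₀ := rfl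

/-- The zone sizes are the landed ones (by `rfl`). [folklore] -/
@[simp] theorem choiceAtQ3V_Sz : (choiceAtQ3V κ Φ t p Pv gv fv Sv cv hv bv hC).Sz = (choiceAtQ3 κ Φ t p Pv gv fv Sv cv bv hC).Sz := rfl

/-- The admissible pairs are the landed ones (by `rfl`; the pair slot `Pv` is read exactly as before). [folklore] -/
@[simp] theorem choiceAtQ3V_SMn : (choiceAtQ3V κ Φ t p Pv gv fv Sv cv hv bv hC).SMn = (choiceAtQ3 κ Φ t p Pv gv fv Sv cv bv hC).SMn := rfl

/-- The anchored cells are `ΓQV` (by `rfl`). [folklore] -/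
@[simp] theorem choiceAtQ3V_Γ (O : OutNS V) (q : unitInterval) : (choiceAtQ3V κ Φ t p Pv gv fv Sv cv hv bv hC).Γ O q = ΓQV κ Φ t p O gv fv Sv cv hv bv q := rfl

/-- The face data are `FDQV` (by `rfl`). [folklore] -/
@[simp] theorem choiceAtQ3V_FD (O : OutNS V) (q : unitInterval) : (choiceAtQ3V κ Φ t p Pv gv fv Sv cv hv bv hC).FD O q = FDQV κ Φ t p O gv fv Sv cv hv q := rfl

/-- The level data are `LDQV` (by `rfl`). [folklore] -/
@[simp] theorem choiceAtQ3V_LD (O : OutNS V) (q : unitInterval) : (choiceAtQ3V κ Φ t p Pv gv fv Sv cv hv bv hC).LD O q = LDQV κ Φ t p O gv fv cv hv := rfl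

/-- The scheme of the T choices of record at `(O, q)` is `⟨ΓQV, q, κ.δ⟩` (by `rfl`). [folklore] -/
theorem choiceAtQ3V_scheme (O : OutNS V) (q : unitInterval) :
    (choiceAtQ3V κ Φ t p Pv gv fv Sv cv hv bv hC).scheme O q = ⟨ΓQV κ Φ t p O gv fv Sv cv hv bv q, q, κ.δ⟩ := rfl

end Values

end NegB

/-! ## §4 The choice function of record under (R-44)/(R-45) -/

/-- **THE CHOICE FUNCTION OF RECORD OF THE FRAMES-ONLY NODE UNDER (R-44)/(R-45), six slots, Step-I‴ accuracy at the cube** (box `gv`, width `fv`, extra pairs `Pv`, fibre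
block `Sv`, creep `cv`, arrival box `bv`; cells `PCells2T`, scheme `cellGeomSG₂bV`): the `ChoiceFnNQ` the four wrappers and the node₂ file meet (closure
`samePDropOfSkeletonFrm₁_of_choiceFnNQLT`). [cite: KozmaNitzan2024, §4 Theorem 6 (pp. 25–31)] -/
def frmChoiceAllQ3V (gv fv : Neg.FSlot) (Pv : NegB.PSlot) (Sv : NegB.SSlot) (cv hv : NegB.CSlot) (bv : NegB.BSlot) : ChoiceFnNQ :=
  fun κ _ _ _ _ _ Φ _ t _ _ p _ _ hC => NegB.choiceAtQ3V κ Φ t p Pv gv fv Sv cv hv bv hC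

/-- `frmChoiceAllQ3V` unfolds to `NegB.choiceAtQ3V` (by `rfl`). [folklore] -/
theorem frmChoiceAllQ3V_eq (gv fv : Neg.FSlot) (Pv : NegB.PSlot) (Sv : NegB.SSlot) (cv hv : NegB.CSlot) (bv : NegB.BSlot) (κ : Consts) {V : Type} [DecidableEq V]
    [Countable V] (G : SimpleGraph V) [G.LocallyFinite] (Φ : PlanarSkeletonFrm G) (hg : ¬ HasExponentialGrowth G) (t : V) (ht : t ∈ Φ.types) (h1 : Φ.types = {t})
    (p : unitInterval) (hp0 : 0 < (p : ℝ)) (hp1 : (p : ℝ) < 1) (hC : Φ.CylSubcritical p) :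
    frmChoiceAllQ3V gv fv Pv Sv cv hv bv κ G Φ hg t ht h1 p hp0 hp1 hC = NegB.choiceAtQ3V κ Φ t p Pv gv fv Sv cv hv bv hC := rfl

/-- The scheme of the choice function of record at `(O, q)` is `⟨ΓQV, q, κ.δ⟩` (by `rfl`) — the form the (R)/(F)/(C) wrappers read. [folklore] -/
theorem frmChoiceAllQ3V_scheme (gv fv : Neg.FSlot) (Pv : NegB.PSlot) (Sv : NegB.SSlot) (cv hv : NegB.CSlot) (bv : NegB.BSlot) (κ : Consts) {V : Type} [DecidableEq V]
    [Countable V] (G : SimpleGraph V) [G.LocallyFinite] (Φ : PlanarSkeletonFrm G) (hg : ¬ HasExponentialGrowth G) (t : V) (ht : t ∈ Φ.types) (h1 : Φ.types = {t})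
    (p : unitInterval) (hp0 : 0 < (p : ℝ)) (hp1 : (p : ℝ) < 1) (hC : Φ.CylSubcritical p) (O : Skelφ.StepI.OutNS V) (q : unitInterval) :
    (frmChoiceAllQ3V gv fv Pv Sv cv hv bv κ G Φ hg t ht h1 p hp0 hp1 hC).scheme O q = ⟨NegB.ΓQV κ Φ t p O gv fv Sv cv hv bv q, q, κ.δ⟩ := rfl

end PlanarSkeletonFrm

end Summit.CriticalPhenomena.PercolationContinuityZ3.Theorems.Transplant

end
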